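import Summits.AnomalousDissipation.AnomalousDissipation.Theorems.BaireTransferDefs
import Summits.AnomalousDissipation.AnomalousDissipation.Theorems.DenseLoudDesignerForces.Negative.WindowBounds

/-!
# `DenseLoudLerayHopfForces` (stmt-AnomalousDissipation-1149), I: reductions and the Leray–Hopf Baire transfer

Support file for the item `DenseLoudLerayHopfForces` of route `BaireTransfer` — the rank-2 crux
`DenseLoudDesignerForces` (stmt-AnomalousDissipation-1143) with GLOBAL LERAY–HOPF witnesses from arbitrary
finite-energy data in place of time-periodic classical orbits.  Nothing here closes the item; the file records the
logical position of the item inside the route.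

* Objects (`lhLoudSet`, `denseLoudLerayHopfForces_iff`, `loudSet_subset_lhLoudSet`, `hasZeroMean_force`) live in
  `BaireTransferDefs`.
* §1 NECESSITY (the planner's "necessary condition for crux #2" made formal): a periodic classical witness is a
  Leray–Hopf witness from its time-zero slice (`IsClassicalNSSolutionOn.isGlobalLerayHopf`, the tree's discharge of
  Robinson–Rodrigo–Sadowski 2016 Thm. 6.5), so `LOUD_j ⊆ LHLOUD_j`, windows of the crux are LH-windows, and
  `DenseLoudDesignerForces → DenseLoudLerayHopfForces` (contrapositively — not stated as a declaration, to keep the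
  crux free of conditional-refutation records — a refutation of the item kills the crux: route kill criterion K4).
* §2 BAIRE TRANSFER AT THE LERAY–HOPF LEVEL — what the item is FOR.  `baire_skeleton`: in a Baire space a
  non-empty open `U` with `U ⊆ closure (interior (L j))` for all `j` contains a point of `⋂ⱼ L j`.  One coefficient
  vector in `⋂ⱼ LHLOUD_j(S,E,ε)` IS the summit (`anomalousDissipation_of_forall_mem_lhLoudSet`: `f_c` is smooth,
  solenoidal, mean-free; `0 < νⱼ < 1/(j+1) → 0`; the budgets are the summit's own functionals), hence:
  the LH-Baire target (interior-density of the LH loud sets in some window) gives `AnomalousDissipation`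
  (`anomalousDissipation_of_lhBaireTarget`); the route's `BaireTarget` gives `AnomalousDissipation` DIRECTLY,
  bypassing `BaireStep` and the CoherentStates thesis (`anomalousDissipation_of_baireTarget`); the two ranked cruxes
  alone give the summit (`anomalousDissipation_of_cruxes`, DensityGlue inlined) — so the support items DensityGlue /
  Assembly are one-liners from here and BaireStep a short consequence of `baire_skeleton` + admissibility of `f_c`; and the item
  itself closes the summit as soon as Leray–Hopf
  loudness can be made force-open after relaxing the budgets (`anomalousDissipation_of_denseLoudLerayHopfForces`,
  the LH analogue of `RobustLoudUpgrade` taken as an explicit hypothesis — no claim that it holds).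

Reading.  The item is strictly between print and the crux: weaker than `DenseLoudDesignerForces` (§1), NOT implied
by the summit (one general smooth force there; a dense set of fixed-degree trig-poly forces here), and its negation
is a uniform quietness theorem for steadily forced 3-D Navier–Stokes at small viscosity in the Leray–Hopf class, on
which nothing is in print (Cheskidov 2023 §1.2; Brué–De Lellis 2023 §2 Q2.1–2.2).  Companion file II (anatomy)
records the kill shape and the a-priori power shell valid for all Leray–Hopf witnesses.
-/

noncomputable section

-- `Summit.<Summit>.<Problem>` is the tree's mandated summit-side namespace (CONVENTIONS §2); for this
-- single-conjunct summit the two coincide, so the duplicate is deliberate.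
set_option linter.dupNamespace false

namespace Summit.AnomalousDissipation.AnomalousDissipation.Theorems.DenseLoudLerayHopfForces

open scoped BigOperators Topology ENNReal InnerProductSpace
open Filter Set MeasureTheory UnitAddTorus
open Literature.Analysis.FunctionSpaces Literature.Analysis.FluidPDE
open Summit.AnomalousDissipation.AnomalousDissipation.Theses.BaireTransfer
open Summit.AnomalousDissipation.AnomalousDissipation.Theorems.DenseLoudDesignerForces.Negative

/-! ## §1 Necessity: periodic classical witnesses are Leray–Hopf witnesses -/

/-- NECESSITY: the crux `DenseLoudDesignerForces` implies the item `DenseLoudLerayHopfForces` (same stock, budgets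
and window; witnesses transported by `loudSet_subset_lhLoudSet`). -/
theorem denseLoudLerayHopfForces_of_denseLoudDesignerForces (h : DenseLoudDesignerForces) :
    DenseLoudLerayHopfForces := by
  intro S₀
  obtain ⟨S, hS, E, ε, hε, U, hU⟩ := denseLoudDesignerForces_iff.1 h S₀
  exact ⟨S, hS, E, ε, hε, U, hU.1, hU.2.1, subset_closure_lhLoudSet_of_isWindow hU⟩

/-! ## §2 Baire transfer at the Leray–Hopf level -/

section Baire

/-- BAIRE SKELETON.  In a Baire space, if a non-empty open `U` satisfies `U ⊆ closure (interior (L j))` for every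
`j : ℕ`, then some point of `U` lies in every `L j`: the sets `D_j := interior (L j) ∪ (closure U)ᶜ` are open and
dense, so `⋂ⱼ D_j` is dense and meets `U`, where `(closure U)ᶜ` is excluded. -/
theorem baire_skeleton {X : Type*} [TopologicalSpace X] [BaireSpace X] {U : Set X} (hU : IsOpen U)
    (hne : U.Nonempty) {L : ℕ → Set X} (hL : ∀ j, U ⊆ closure (interior (L j))) :
    ∃ c ∈ U, ∀ j, c ∈ L j := by
  set D : ℕ → Set X := fun j => interior (L j) ∪ (closure U)ᶜ with hD
  have hDo : ∀ j, IsOpen (D j) := fun j => isOpen_interior.union isClosed_closure.isOpen_compl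
  have hDd : ∀ j, Dense (D j) := by
    intro j
    rw [dense_iff_inter_open]
    intro W hW hWne
    by_cases h : (W ∩ (closure U)ᶜ).Nonempty
    · obtain ⟨x, hxW, hx⟩ := h
      exact ⟨x, hxW, Or.inr hx⟩
    · have hWU : W ⊆ closure U := fun x hxW => by
        by_contra hx
        exact h ⟨x, hxW, hx⟩
      obtain ⟨x, hxW⟩ := hWne
      obtain ⟨y, hyW, hyU⟩ := mem_closure_iff.1 (hWU hxW) W hW hxW
      obtain ⟨z, hzW, hz⟩ := mem_closure_iff.1 (hL j hyU) W hW hyW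
      exact ⟨z, hzW, Or.inl hz⟩
  have hdense : Dense (⋂ j, D j) := dense_iInter_of_isOpen_nat hDo hDd
  obtain ⟨c, hcU, hc⟩ := hdense.inter_open_nonempty U hU hne
  refine ⟨c, hcU, fun j => ?_⟩
  rcases mem_iInter.1 hc j with h | h
  · exact interior_subset h
  · exact absurd (subset_closure hcU) h

variable {S : Finset (Fin 3 → ℤ)}

/-- ONE FORCE LOUD AT EVERY LEVEL IS THE SUMMIT: if a single coefficient vector `c` lies in every
`LHLOUD_j(S,E,ε)` (`ε > 0`), then `AnomalousDissipation` holds with the steady force `f_c` — smooth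
(`isSmooth_force`), solenoidal (`isDivFree_force`), mean-free (`hasZeroMean_force`) — the level witnesses
`(νⱼ, u₀ⱼ, uⱼ)`, `0 < νⱼ < 1/(j+1) → 0` by squeezing, and the budgets `E`, `ε` verbatim. -/
theorem anomalousDissipation_of_forall_mem_lhLoudSet {E ε : ℝ} (hε : 0 < ε)
    {c : ↥S → (EuclideanSpace ℂ (Fin 3))} (hc : ∀ j : ℕ, c ∈ lhLoudSet S E ε j) : AnomalousDissipation := by
  choose ν hν hνj u₀ u hu hEu hεu using hc
  refine ⟨force S c, isSmooth_force S c, isDivFree_force S c, hasZeroMean_force S c, ν, u₀, u, hν, ?_, hu,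
    ⟨E, hEu⟩, ε, hε, hεu⟩
  exact squeeze_zero (fun j => (hν j).le) (fun j => (hνj j).le) tendsto_one_div_add_atTop_nhds_zero_nat

/-- LH-BAIRE TARGET ⇒ SUMMIT: if in some non-empty open `U ⊆ P_S` the ROBUSTLY Leray–Hopf-loud forces
`interior (LHLOUD_j(S,E,ε))` are dense at every level, then `AnomalousDissipation` (Baire on the complete
finite-dimensional `P_S`, then `anomalousDissipation_of_forall_mem_lhLoudSet`).  No periodic orbits are needed at
the Leray–Hopf level. -/
theorem anomalousDissipation_of_lhBaireTarget
    (h : ∃ (S : Finset (Fin 3 → ℤ)) (E ε : ℝ), 0 < ε ∧ ∃ U : Set (↥S → (EuclideanSpace ℂ (Fin 3))),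
      IsOpen U ∧ U.Nonempty ∧ ∀ j : ℕ, U ⊆ closure (interior (lhLoudSet S E ε j))) :
    AnomalousDissipation := by
  obtain ⟨S, E, ε, hε, U, hU, hne, hW⟩ := h
  obtain ⟨c, -, hc⟩ := baire_skeleton hU hne hW
  exact anomalousDissipation_of_forall_mem_lhLoudSet hε hc

/-- `BaireTarget` ⇒ SUMMIT, directly: the route's thesis X gives `AnomalousDissipation` without passing through
`BaireStep` / the CoherentStates thesis (`interior LOUD_j ⊆ interior LHLOUD_j` by §1). -/
theorem anomalousDissipation_of_baireTarget (h : BaireTarget) : AnomalousDissipation := by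
  obtain ⟨S, E, ε, hε, U, hU, hne, hW⟩ := h
  refine anomalousDissipation_of_lhBaireTarget ⟨S, E, ε, hε, U, hU, hne, fun j => (hW j).trans ?_⟩
  exact closure_mono (interior_mono (loudSet_subset_lhLoudSet S E ε j))

/-- THE TWO RANKED CRUXES ALONE GIVE THE SUMMIT (`DensityGlue` inlined: budgets `(2E, ε/2)`, `closure_mono` and
`closure_closure`; then `anomalousDissipation_of_baireTarget`).  The route's support items DensityGlue and Assembly
are one-line consequences of this file (BaireStep: `baire_skeleton` + admissibility of `f_c`). -/
theorem anomalousDissipation_of_cruxes (h₂ : DenseLoudDesignerForces) (h₃ : RobustLoudUpgrade) :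
    AnomalousDissipation := by
  obtain ⟨S₀, hS₀⟩ := h₃
  obtain ⟨S, hS, E, ε, hε, U, hU, hne, hW⟩ := h₂ S₀
  refine anomalousDissipation_of_baireTarget ⟨S, 2 * E, ε / 2, by positivity, U, hU, hne, fun j => ?_⟩
  have h : loudSet S E ε j ⊆ closure (interior (loudSet S (2 * E) (ε / 2) j)) := hS₀ S hS E ε hε j
  calc U ⊆ closure (loudSet S E ε j) := hW j
    _ ⊆ closure (closure (interior (loudSet S (2 * E) (ε / 2) j))) := closure_mono h
    _ = closure (interior (loudSet S (2 * E) (ε / 2) j)) := closure_closure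

/-- WHAT THE ITEM IS FOR: `DenseLoudLerayHopfForces` together with a Leray–Hopf ROBUST-LOUD UPGRADE (every
LH-loud force is a limit of robustly LH-loud forces after relaxing the budgets by `2`, for all stocks containing
some `S₀` — the LH analogue of the crux `RobustLoudUpgrade`, taken here as an explicit HYPOTHESIS, not asserted)
gives `AnomalousDissipation`, with Leray–Hopf witnesses throughout and no periodic orbits. -/
theorem anomalousDissipation_of_denseLoudLerayHopfForces (h₁ : DenseLoudLerayHopfForces)
    (hup : ∃ S₀ : Finset (Fin 3 → ℤ), ∀ S : Finset (Fin 3 → ℤ), S₀ ⊆ S → ∀ (E ε : ℝ), 0 < ε → ∀ j : ℕ,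
      lhLoudSet S E ε j ⊆ closure (interior (lhLoudSet S (2 * E) (ε / 2) j))) :
    AnomalousDissipation := by
  obtain ⟨S₀, hS₀⟩ := hup
  obtain ⟨S, hS, E, ε, hε, U, hU, hne, hW⟩ := h₁ S₀
  refine anomalousDissipation_of_lhBaireTarget ⟨S, 2 * E, ε / 2, by positivity, U, hU, hne, fun j => ?_⟩
  calc U ⊆ closure (lhLoudSet S E ε j) := hW j
    _ ⊆ closure (closure (interior (lhLoudSet S (2 * E) (ε / 2) j))) := closure_mono (hS₀ S hS E ε hε j)
    _ = closure (interior (lhLoudSet S (2 * E) (ε / 2) j)) := closure_closure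

end Baire

end Summit.AnomalousDissipation.AnomalousDissipation.Theorems.DenseLoudLerayHopfForces

end
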